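import Summits.BirchSwinnertonDyer.BirchSwinnertonDyer.Theorems.ManinLocalTwoThreePinningOneSeventySixRowsData


/-!
(Part B of 2: the named-form identifications; the data, kernel certificates and row identities are in part A
 `…PinningOneSeventySixRowsData`.)

# Level 176, part 4: THE NEWFORM ROW `176c` — `D.f = (Φ₄₄)^{χ₋₄}`, FACT-FREE

Cell `bsd-f2-manin`, route `ManinLocalTwoThree`, crux C2 `ManinOddAtFour` (stmt-BirchSwinnertonDyer-22967; `4 ∣ 176`, `9 ∤ 176`),
an g55 (LENS analytic/periods); `--supports stmt-BirchSwinnertonDyer-22967` (helper).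
Parts 1–3 (`…PinningOneSeventySix{Tables,TablesB,}`) prove `pinning`: for every `X₀(176)`-datum `D`, `d′ • D.f = Σ_j y_j • C_j` in
`M₂(Γ₀(176))` for one of the three surviving certificates (`176c`: `d′ = 150`; `176b`, `176a`: `d′ = 1732`).  This part IDENTIFIES the
`176c` combination with the `χ₋₄`-TWIST OF THE TREE'S LEVEL-44 NEWFORM `Φ₄₄` (`LevelFortyFour.Phi44 = Σ phi44Coords i • ![O 1, O 2, O 4,
B1, …, B6]`, `LevelFortyFour.f_apply_eq_phi44 : ⇑D₀.f = ⇑Φ₄₄` for every `X₀(44)`-datum `D₀`) by the row lemma of part F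
(`…PinningKernelRows.eq_of_smul_eq_sum_of_row`: one decidable integer identity `150·tabT[n] = Σ_j y_j·tabs_j[n]`, `n < 64`):
* `tabPhi44_eq_coeff`: `aₙ(Φ₄₄) = tabPhi44[n]` for `n < 64`, from depth-64 SPARSE `η`-certificates of `φ₁₁ = η₁²η₁₁²` (level 11) and of
  the tree's `B1`, `B2`, `B4` (level 44), the old-form coefficient formula `aₙ(ι_d φ₁₁) = d·[d ∣ n]·a_{n/d}(φ₁₁)`
  (tree `Theorems.LTwist.cuspCoeff_degeneracyMap0`) and the tree's `LevelFortyFour.coeff_sum_smul` (this extends the tree's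
  `coeff_Phi44` from `n ≤ 33` to `n < 64`);
* `tabT_eq_modCoef_charTwist`: `aₙ(φ^{χ₋₄}) = χ₋₄(n)·aₙ(φ) = tabT[n]` (`Literature…CuspFormTwist.cuspCoeff_charTwist`) for any
  `φ ∈ S₂(Γ₀(44))` with `⇑φ = ⇑Φ₄₄`;
* **`f_eq_charTwist_or (D) (φ) (hφ)`**: `(a_p(W))_p = σ₁₇₆c ∧ D.f = charTwist 176 _ _ χ₋₄ φ`, or `(a_p(W))_p ∈ {σ₁₇₆_b, σ₁₇₆ₐ}`;
  **`f_eq_charTwist_of_lFunction_three (h3 : a₃(W) = −1)`** and **`cuspCoeff_f_eq_chi_mul`**: `aₙ(D.f) = χ₋₄(n)·aₙ(φ)` for ALL `n`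
  — exactly the input `hf` of desc's `abs_maninConstant_eq_one_oneSeventySixC_of_cuspCoeff/_of_rootDatum` (`Sketch-desc-g46`, with
  `φ = D₀.f`, `hφ = LevelFortyFour.f_apply_eq_phi44 D₀`).  No root form is constructed here (`Φ₄₄` is a `ModularForm`; a cusp form with
  these values is `D₀.f` for any `X₀(44)`-datum `D₀`).
HONEST FRAMING: unconditional, standard axioms, kernel certificates + linear algebra; no Hecke theory, no Sturm bound; the Néron/`c`-side
is NOT touched here; rows `176a/176b` are only named, not identified; nothing in this file proves C2, Manin's conjecture or BSD.
[cite: CremonaAlgorithms1997, §2.10, Table 1 (176a–c), Table 3 (N = 44)] [cite: Shimura1971, Prop. 3.64] [cite: Koehler2011, §2.1]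
[cite: DiamondShurman2005, §5.7 p. 211]
-/

set_option autoImplicit false
-- lint-debt: the directory name repeats the summit name (sibling precedent `ManinLocalTwoThreePinningSixtyThree.lean`)
set_option linter.dupNamespace false

noncomputable section

open Complex
open UpperHalfPlane hiding I
open scoped MatrixGroups ModularForm
open ModularForm CongruenceSubgroup PowerSeries
open Literature.NumberTheory.ModularForms
open Literature.NumberTheory.EllipticCurves Literature.NumberTheory.EllipticCurves.ModularForms

namespace Summit.BirchSwinnertonDyer.BirchSwinnertonDyer.Theorems.ManinLocalTwoThree.PinningOneSeventySix

open Summit.BirchSwinnertonDyer.BirchSwinnertonDyer.Theorems.ManinLocalTwoThree.BracketSturm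
open Summit.BirchSwinnertonDyer.BirchSwinnertonDyer.Theorems.ManinLocalTwoThree.PinningKernel
open Summit.BirchSwinnertonDyer.BirchSwinnertonDyer.Theorems.ManinLocalTwoThree.LevelFortyFour

set_option maxHeartbeats 4000000
set_option maxRecDepth 16384

/-! ## §3 The tables of `φ₁₁`, `Φ₄₄`, the level-`88` root form and the three twists -/

/-- `φ₁₁ = η₁²η₁₁²` pointwise as an `η`-quotient of level `11`. [cite: Koehler2011, §2.1] -/
theorem phi11_eq_etaQuotient (τ : ℍ) : cuspFormEtaProductEleven τ = etaQuotient 11 (expFn [(1, 2), (11, 2)]) τ := by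
  rw [show (cuspFormEtaProductEleven : ℍ → ℂ) τ = etaProductEleven τ from rfl, etaProductEleven_apply,
    etaQuotient_apply, show (11 : ℕ).divisors = {1, 11} from by decide, Finset.prod_insert (by decide),
    Finset.prod_singleton]
  have e : expFn [(1, 2), (11, 2)] 1 = 2 ∧ expFn [(1, 2), (11, 2)] 11 = 2 := by decide
  rw [e.1, e.2]
  push_cast
  rw [one_mul]
  norm_cast

/-- **`aₙ(φ₁₁) = tabPhi11[n]`, `n < 64`.** [cite: Koehler2011, §2.1] -/
theorem tabPhi11_eq_cuspCoeff : ∀ n < 64, ((tabPhi11.getD n 0 : ℤ) : ℂ) = cuspCoeff cuspFormEtaProductEleven n :=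
  qExpansion_coeff_eq_of_etaCertificateSparse_cuspForm cuspFormEtaProductEleven (expFn [(1, 2), (11, 2)])
    phi11_eq_etaQuotient 1 hS.1 tabPhi11 hcertPhi11

/-- **`aₙ(ι_d φ₁₁) = t[n]`** for a table `t` with `t[n] = d·[d ∣ n]·tabPhi11[n/d]`, `n < 64`. [cite: DiamondShurman2005, §5.7 p. 211] -/
theorem cuspCoeff_iota_eq (d : ℕ) [NeZero d] (hd : 11 * d ∣ 44) (t : List ℤ)
    (ht : ∀ n < 64, t.getD n 0 = (d : ℕ) * (if d ∣ n then tabPhi11.getD (n / d) 0 else 0)) (n : ℕ) (hn : n < 64) :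
    cuspCoeff (degeneracyMap0 11 44 d 2 cuspFormEtaProductEleven) n = ((t.getD n 0 : ℤ) : ℂ) := by
  rw [Summit.BirchSwinnertonDyer.BirchSwinnertonDyer.Theorems.LTwist.cuspCoeff_degeneracyMap0 hd cuspFormEtaProductEleven n,
    show ((2 : ℤ) - 1) = 1 by norm_num, zpow_one, ht n hn]
  by_cases hdn : d ∣ n
  · have hlt : n / d < 64 := lt_of_le_of_lt (Nat.div_le_self n d) hn
    rw [if_pos hdn, if_pos hdn, ← tabPhi11_eq_cuspCoeff (n / d) hlt]
    push_cast
    ring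
  · rw [if_neg hdn, if_neg hdn]
    push_cast
    ring

/-- **`aₙ(Φ₄₄) = tabPhi44[n]`, `n < 64`** (extends the tree's `coeff_Phi44`, `n ≤ 33`). [cite: CremonaAlgorithms1997, Table 3 (N = 44)] -/
theorem tabPhi44_eq_coeff : ∀ n < 64, ((tabPhi44.getD n 0 : ℤ) : ℂ) = (qExpansion 1 ⇑Phi44).coeff n := by
  intro n hn
  obtain ⟨v0, v1, v2, v3, v4, v5, v6, v7, v8⟩ := phi44Coords_values
  have hB1 := qExpansion_coeff_eq_of_etaCertificateSparse B1 rB1 (fun τ ↦ rfl) 11 hS.2.1 tabB1 hcertB1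
  have hB2 := qExpansion_coeff_eq_of_etaCertificateSparse B2 rB2 (fun τ ↦ rfl) 1 hS.2.2.1 tabB2 hcertB2
  have hB4 := qExpansion_coeff_eq_of_etaCertificateSparse B4 rB4 (fun τ ↦ rfl) 1 hS.2.2.2 tabB4 hcertB4
  have hc : (5 : ℂ) * ((tabPhi44.getD n 0 : ℤ) : ℂ) = -6 * ((tabO1.getD n 0 : ℤ) : ℂ) + -6 * ((tabO2.getD n 0 : ℤ) : ℂ) +
      -3 * ((tabO4.getD n 0 : ℤ) : ℂ) + 4 * ((tabB1.getD n 0 : ℤ) : ℂ) + 15 * ((tabB2.getD n 0 : ℤ) : ℂ) +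
      -4 * ((tabB4.getD n 0 : ℤ) : ℂ) := by
    exact_mod_cast hPhi n hn
  rw [Phi44, coeff_sum_smul]
  simp only [Fin.sum_univ_succ, Fin.sum_univ_zero, basisForms, Matrix.cons_val_zero, Matrix.cons_val_succ,
    finSucc1, finSucc2, finSucc3, finSucc4, finSucc5, finSucc6, finSucc7, finSucc8, v0, v1, v2, v3, v4, v5, v6, v7, v8,
    coeff_O, cuspCoeff_iota_eq 1 (by norm_num) tabO1 hO.1 n hn, cuspCoeff_iota_eq 2 (by norm_num) tabO2 hO.2.1 n hn,
    cuspCoeff_iota_eq 4 (by norm_num) tabO4 hO.2.2 n hn, ← hB1 n hn, ← hB2 n hn, ← hB4 n hn]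
  linear_combination (1 / 5 : ℂ) * hc

/-- **`aₙ(φ) = tabPhi44[n]`, `n < 64`, for any `φ ∈ S₂(Γ₀(44))` with `⇑φ = ⇑Φ₄₄`** (e.g. `φ = D₀.f`, `LevelFortyFour.f_apply_eq_phi44`).
[cite: CremonaAlgorithms1997, Table 3 (N = 44)] -/
theorem tabPhi44_eq_cuspCoeff (φ : CuspForm (Gamma0 44) 2) (hφ : ⇑φ = ⇑Phi44) :
    ∀ n < 64, ((tabPhi44.getD n 0 : ℤ) : ℂ) = cuspCoeff φ n := by
  intro n hn
  rw [show cuspCoeff φ n = (qExpansion 1 ⇑φ).coeff n from rfl, hφ]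
  exact tabPhi44_eq_coeff n hn

/-- **`aₙ(φ^{χ₋₄}) = tabT[n]` for `n < 64`**, for any `φ ∈ S₂(Γ₀(44))` with `⇑φ = ⇑Φ₄₄`. [cite: Shimura1971, Prop. 3.64] -/
theorem tabT_eq_modCoef_charTwist (φ : CuspForm (Gamma0 44) 2) (hφ : ⇑φ = ⇑Phi44) :
    ∀ n < 64, ((tabT.getD n 0 : ℤ) : ℂ) = modCoefₗ 176 2 n (ModularFormClass.modularForm
      (charTwist 176 (⟨4, rfl⟩ : 44 ∣ 176) (⟨11, rfl⟩ : 4 ^ 2 ∣ 176) isQuadratic_χ₄_ringHomComp φ)) := by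
  intro n hn
  have h := hTw n hn
  rw [← ZMod.χ₄_nat_eq_if_mod_four] at h
  have hc : ((tabT.getD n 0 : ℤ) : ℂ) = ((ZMod.χ₄ n : ℤ) : ℂ) * ((tabPhi44.getD n 0 : ℤ) : ℂ) := by
    exact_mod_cast h
  rw [modCoefₗ_modularForm, cuspCoeff_charTwist 176 _ _ isQuadratic_χ₄_ringHomComp isPrimitive_χ₄_ringHomComp,
    χ₄_ringHomComp_apply_natCast, ← tabPhi44_eq_cuspCoeff φ hφ n hn]
  exact hc

/-- **`aₙ((φ₁₁)^{χ₋₄}) = tabTb[n]` for `n < 64`.** [cite: Shimura1971, Prop. 3.64] -/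
theorem tabTb_eq_modCoef_charTwist :
    ∀ n < 64, ((tabTb.getD n 0 : ℤ) : ℂ) = modCoefₗ 176 2 n (ModularFormClass.modularForm
      (charTwist 176 (⟨16, rfl⟩ : 11 ∣ 176) (⟨11, rfl⟩ : 4 ^ 2 ∣ 176) isQuadratic_χ₄_ringHomComp cuspFormEtaProductEleven)) := by
  intro n hn
  have h := hTwb n hn
  rw [← ZMod.χ₄_nat_eq_if_mod_four] at h
  have hc : ((tabTb.getD n 0 : ℤ) : ℂ) = ((ZMod.χ₄ n : ℤ) : ℂ) * ((tabPhi11.getD n 0 : ℤ) : ℂ) := by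
    exact_mod_cast h
  rw [modCoefₗ_modularForm, cuspCoeff_charTwist 176 _ _ isQuadratic_χ₄_ringHomComp isPrimitive_χ₄_ringHomComp,
    χ₄_ringHomComp_apply_natCast, ← tabPhi11_eq_cuspCoeff n hn]
  exact hc

/-- **`aₙ(D₈₈.f) = tab88a[n]`, `n < 64`, for EVERY `X₀(88)`-datum `D₈₈`** — from the tree's `PinningEightyEight.pinning_eightyEight`
(`176 • D₈₈.f = Σ_j (y88a)_j • C_j`) and depth-64 sparse certificates of its sixteen `η`-quotients. [cite: CremonaAlgorithms1997, Table 1 (88a)] -/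
theorem tab88a_eq_cuspCoeff {W₈₈ : WeierstrassCurve ℚ} [W₈₈.IsElliptic] (D₈₈ : ModularParametrizationData W₈₈ 88) :
    ∀ n < 64, ((tab88a.getD n 0 : ℤ) : ℂ) = cuspCoeff D₈₈.f n := by
  obtain ⟨C, hC, -, hpin⟩ := PinningEightyEight.pinning_eightyEight D₈₈
  have ht := tables_of_etaCertsSparse 88 64 (fun i : Fin 16 ↦ expFn (PinningEightyEight.Ls[(i : ℕ)]).1)
    (fun i ↦ PinningEightyEight.shifts i) t88 C hC PinningEightyEight.hshift hcert88
  intro n hn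
  have h := congrArg (modCoefₗ 88 2 n) hpin
  simp only [map_smul, map_sum, smul_eq_mul, modCoefₗ_modularForm] at h
  have h2 : ∑ j : Fin 16, ((PinningEightyEight.y88a.getD (j : ℕ) 0 : ℤ) : ℂ) * modCoefₗ 88 2 n (C j) =
      ∑ j : Fin 16, ((PinningEightyEight.y88a.getD (j : ℕ) 0 : ℤ) : ℂ) * (((t88 j).getD n 0 : ℤ) : ℂ) :=
    Finset.sum_congr rfl (fun j _ ↦ by rw [ht j n hn])
  have h3 : ((176 : ℤ) : ℂ) * ((tab88a.getD n 0 : ℤ) : ℂ) =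
      ∑ j : Fin 16, ((PinningEightyEight.y88a.getD (j : ℕ) 0 : ℤ) : ℂ) * (((t88 j).getD n 0 : ℤ) : ℂ) := by
    exact_mod_cast hrow88 n hn
  rw [h2, ← h3] at h
  have h176 : ((176 : ℤ) : ℂ) ≠ 0 := by norm_num
  exact (mul_left_cancel₀ h176 h).symm

/-- **`aₙ((D₈₈.f)^{χ₋₄}) = tabTa[n]` for `n < 64`**, for every `X₀(88)`-datum `D₈₈`. [cite: Shimura1971, Prop. 3.64] -/
theorem tabTa_eq_modCoef_charTwist {W₈₈ : WeierstrassCurve ℚ} [W₈₈.IsElliptic] (D₈₈ : ModularParametrizationData W₈₈ 88) :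
    ∀ n < 64, ((tabTa.getD n 0 : ℤ) : ℂ) = modCoefₗ 176 2 n (ModularFormClass.modularForm
      (charTwist 176 (⟨2, rfl⟩ : 88 ∣ 176) (⟨11, rfl⟩ : 4 ^ 2 ∣ 176) isQuadratic_χ₄_ringHomComp D₈₈.f)) := by
  intro n hn
  have h := hTwa n hn
  rw [← ZMod.χ₄_nat_eq_if_mod_four] at h
  have hc : ((tabTa.getD n 0 : ℤ) : ℂ) = ((ZMod.χ₄ n : ℤ) : ℂ) * ((tab88a.getD n 0 : ℤ) : ℂ) := by
    exact_mod_cast h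
  rw [modCoefₗ_modularForm, cuspCoeff_charTwist 176 _ _ isQuadratic_χ₄_ringHomComp isPrimitive_χ₄_ringHomComp,
    χ₄_ringHomComp_apply_natCast, ← tab88a_eq_cuspCoeff D₈₈ n hn]
  exact hc

/-! ## §4 The three rows -/

/-- **LEVEL 176: THE THREE ROWS.**  For every `X₀(176)`-datum `D` of an elliptic `W/ℚ` and any `φ ∈ S₂(Γ₀(44))` with `⇑φ = ⇑Φ₄₄`:
`(a_p(W))_{p ∈ stage primes} = σ₁₇₆c ∧ D.f = φ^{χ₋₄}`, or `(a_p(W))_p = σ₁₇₆_b ∧ D.f = (φ₁₁)^{χ₋₄}`, or `(a_p(W))_p = σ₁₇₆ₐ`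
(and then `D.f = (D₈₈.f)^{χ₋₄}` for every `X₀(88)`-datum `D₈₈`: `f_eq_charTwist_eightyEight`).
[cite: CremonaAlgorithms1997, §2.10, Table 1 (176a–c)] [cite: Shimura1971, Prop. 3.64] -/
theorem f_eq_charTwist_or {W : WeierstrassCurve ℚ} [W.IsElliptic] (D : ModularParametrizationData W 176)
    (φ : CuspForm (Gamma0 44) 2) (hφ : ⇑φ = ⇑Phi44) :
    (truth W [2, 3, 5, 7, 13, 17, 11, 19, 23, 29, 31] = rowC.1 ∧
      D.f = charTwist 176 (⟨4, rfl⟩ : 44 ∣ 176) (⟨11, rfl⟩ : 4 ^ 2 ∣ 176) isQuadratic_χ₄_ringHomComp φ) ∨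
    (truth W [2, 3, 5, 7, 13, 17, 11, 19, 23, 29, 31] = rowB.1 ∧
      D.f = charTwist 176 (⟨16, rfl⟩ : 11 ∣ 176) (⟨11, rfl⟩ : 4 ^ 2 ∣ 176) isQuadratic_χ₄_ringHomComp cuspFormEtaProductEleven) ∨
    truth W [2, 3, 5, 7, 13, 17, 11, 19, 23, 29, 31] = rowA.1 := by
  haveI : FiniteDimensional ℂ (ModularForm (Gamma0 176) 2) := Module.finite_of_finrank_eq_succ finrank_modularForm_two
  obtain ⟨C, hC, c, hc, htruth, hpin⟩ := pinning D
  have ht := tables_of_etaCertsSparse 176 64 (fun i : Fin 30 ↦ expFn (Ls[(i : ℕ)]).1) (fun i ↦ shifts i) tabs C hC hshift hcert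
  rw [stages_map_fst] at htruth
  rw [goodCerts_eq_rows] at hc
  simp only [List.mem_cons, List.mem_nil_iff, or_false] at hc
  rcases hc with rfl | rfl | rfl
  · exact Or.inl ⟨htruth, cuspForm_eq_of_modularForm_eq (eq_of_smul_eq_sum_of_row C tabs duals 45724800 ht hlen hdual (by norm_num)
      finrank_modularForm_two _ tabT (tabT_eq_modCoef_charTwist φ hφ) rowC.2.1 (by decide) rowC.2.2 hpin hrowC)⟩
  · exact Or.inr (Or.inl ⟨htruth, cuspForm_eq_of_modularForm_eq (eq_of_smul_eq_sum_of_row C tabs duals 45724800 ht hlen hdual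
      (by norm_num) finrank_modularForm_two _ tabTb tabTb_eq_modCoef_charTwist rowB.2.1 (by decide) rowB.2.2 hpin hrowB)⟩)
  · exact Or.inr (Or.inr htruth)

/-- **Row `176a`**: if `(a_p(W))_p = σ₁₇₆ₐ` then `D.f = (D₈₈.f)^{χ₋₄}` for every `X₀(88)`-datum `D₈₈`.
[cite: CremonaAlgorithms1997, Table 1 (176a, 88a)] [cite: Shimura1971, Prop. 3.64] -/
theorem f_eq_charTwist_eightyEight {W₈₈ : WeierstrassCurve ℚ} [W₈₈.IsElliptic] (D₈₈ : ModularParametrizationData W₈₈ 88)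
    {W : WeierstrassCurve ℚ} [W.IsElliptic] (D : ModularParametrizationData W 176) (hA : truth W [2, 3, 5, 7, 13, 17, 11, 19, 23, 29, 31] = rowA.1) :
    D.f = charTwist 176 (⟨2, rfl⟩ : 88 ∣ 176) (⟨11, rfl⟩ : 4 ^ 2 ∣ 176) isQuadratic_χ₄_ringHomComp D₈₈.f := by
  haveI : FiniteDimensional ℂ (ModularForm (Gamma0 176) 2) := Module.finite_of_finrank_eq_succ finrank_modularForm_two
  obtain ⟨C, hC, c, hc, htruth, hpin⟩ := pinning D
  have ht := tables_of_etaCertsSparse 176 64 (fun i : Fin 30 ↦ expFn (Ls[(i : ℕ)]).1) (fun i ↦ shifts i) tabs C hC hshift hcert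
  rw [stages_map_fst] at htruth
  rw [goodCerts_eq_rows] at hc
  simp only [List.mem_cons, List.mem_nil_iff, or_false] at hc
  rcases hc with rfl | rfl | rfl
  · exact absurd (htruth.symm.trans hA) rows_ne.2.1
  · exact absurd (htruth.symm.trans hA) rows_ne.2.2
  · exact cuspForm_eq_of_modularForm_eq (eq_of_smul_eq_sum_of_row C tabs duals 45724800 ht hlen hdual (by norm_num)
      finrank_modularForm_two _ tabTa (tabTa_eq_modCoef_charTwist D₈₈) rowA.2.1 (by decide) rowA.2.2 hpin hrowA)

/-- `a₃(W)` read off a truth row. [folklore] -/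
theorem lFunction_three_of_truth {W : WeierstrassCurve ℚ} [W.IsElliptic] (row : List (ℕ × ℤ) × ℤ × List ℤ)
    (h : truth W [2, 3, 5, 7, 13, 17, 11, 19, 23, 29, 31] = row.1) : W.LFunction 3 = (row.1.getD 1 (0, 0)).2 := by
  have h' := congrArg (fun l : List (ℕ × ℤ) ↦ (l.getD 1 (0, 0)).2) h
  simpa [truth] using h'

/-- **`a₃(W) ∈ {−1, 1, 3}` for every `X₀(176)`-datum.** [cite: CremonaAlgorithms1997, Table 1 (176a–c)] -/
theorem lFunction_three_cases {W : WeierstrassCurve ℚ} [W.IsElliptic] (D : ModularParametrizationData W 176) :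
    W.LFunction 3 = -1 ∨ W.LFunction 3 = 1 ∨ W.LFunction 3 = 3 := by
  haveI : FiniteDimensional ℂ (ModularForm (Gamma0 176) 2) := Module.finite_of_finrank_eq_succ finrank_modularForm_two
  obtain ⟨C, hC, c, hc, htruth, hpin⟩ := pinning D
  rw [stages_map_fst] at htruth
  rw [goodCerts_eq_rows] at hc
  simp only [List.mem_cons, List.mem_nil_iff, or_false] at hc
  rcases hc with rfl | rfl | rfl
  · exact Or.inl (by simpa [rowC] using lFunction_three_of_truth rowC htruth)
  · exact Or.inr (Or.inl (by simpa [rowB] using lFunction_three_of_truth rowB htruth))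
  · exact Or.inr (Or.inr (by simpa [rowA] using lFunction_three_of_truth rowA htruth))

/-- **The `176c` row selected by `a₃(W) = −1`**: `D.f = φ^{χ₋₄}` (`⇑φ = ⇑Φ₄₄`). [cite: CremonaAlgorithms1997, Table 1 (176c)] -/
theorem f_eq_charTwist_of_lFunction_three {W : WeierstrassCurve ℚ} [W.IsElliptic] (D : ModularParametrizationData W 176)
    (φ : CuspForm (Gamma0 44) 2) (hφ : ⇑φ = ⇑Phi44) (h3 : W.LFunction 3 = -1) :
    D.f = charTwist 176 (⟨4, rfl⟩ : 44 ∣ 176) (⟨11, rfl⟩ : 4 ^ 2 ∣ 176) isQuadratic_χ₄_ringHomComp φ := by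
  rcases f_eq_charTwist_or D φ hφ with ⟨_, h⟩ | ⟨h, _⟩ | h
  · exact h
  · have h' := lFunction_three_of_truth rowB h
    simp only [rowB, List.getD_cons_succ, List.getD_cons_zero] at h'
    omega
  · have h' := lFunction_three_of_truth rowA h
    simp only [rowA, List.getD_cons_succ, List.getD_cons_zero] at h'
    omega

/-- **The `176b` row selected by `a₃(W) = 1`**: `D.f = (φ₁₁)^{χ₋₄}` — an EXPLICIT root form, no root datum needed.
[cite: CremonaAlgorithms1997, Table 1 (176b, 11a)] -/
theorem f_eq_charTwist_eleven_of_lFunction_three {W : WeierstrassCurve ℚ} [W.IsElliptic] (D : ModularParametrizationData W 176)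
    (h3 : W.LFunction 3 = 1) :
    D.f = charTwist 176 (⟨16, rfl⟩ : 11 ∣ 176) (⟨11, rfl⟩ : 4 ^ 2 ∣ 176) isQuadratic_χ₄_ringHomComp cuspFormEtaProductEleven := by
  haveI : FiniteDimensional ℂ (ModularForm (Gamma0 176) 2) := Module.finite_of_finrank_eq_succ finrank_modularForm_two
  obtain ⟨C, hC, c, hc, htruth, hpin⟩ := pinning D
  have ht := tables_of_etaCertsSparse 176 64 (fun i : Fin 30 ↦ expFn (Ls[(i : ℕ)]).1) (fun i ↦ shifts i) tabs C hC hshift hcert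
  rw [stages_map_fst] at htruth
  rw [goodCerts_eq_rows] at hc
  simp only [List.mem_cons, List.mem_nil_iff, or_false] at hc
  rcases hc with rfl | rfl | rfl
  · have h' := lFunction_three_of_truth rowC htruth
    simp only [rowC, List.getD_cons_succ, List.getD_cons_zero] at h'
    omega
  · exact cuspForm_eq_of_modularForm_eq (eq_of_smul_eq_sum_of_row C tabs duals 45724800 ht hlen hdual (by norm_num)
      finrank_modularForm_two _ tabTb tabTb_eq_modCoef_charTwist rowB.2.1 (by decide) rowB.2.2 hpin hrowB)
  · have h' := lFunction_three_of_truth rowA htruth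
    simp only [rowA, List.getD_cons_succ, List.getD_cons_zero] at h'
    omega

/-- **The `176a` row selected by `a₃(W) = 3`**: `D.f = (D₈₈.f)^{χ₋₄}` for every `X₀(88)`-datum `D₈₈`.
[cite: CremonaAlgorithms1997, Table 1 (176a, 88a)] -/
theorem f_eq_charTwist_eightyEight_of_lFunction_three {W₈₈ : WeierstrassCurve ℚ} [W₈₈.IsElliptic]
    (D₈₈ : ModularParametrizationData W₈₈ 88) {W : WeierstrassCurve ℚ} [W.IsElliptic] (D : ModularParametrizationData W 176)
    (h3 : W.LFunction 3 = 3) :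
    D.f = charTwist 176 (⟨2, rfl⟩ : 88 ∣ 176) (⟨11, rfl⟩ : 4 ^ 2 ∣ 176) isQuadratic_χ₄_ringHomComp D₈₈.f := by
  haveI : FiniteDimensional ℂ (ModularForm (Gamma0 176) 2) := Module.finite_of_finrank_eq_succ finrank_modularForm_two
  obtain ⟨C, hC, c, hc, htruth, -⟩ := pinning D
  rw [stages_map_fst] at htruth
  rw [goodCerts_eq_rows] at hc
  simp only [List.mem_cons, List.mem_nil_iff, or_false] at hc
  rcases hc with rfl | rfl | rfl
  · have h' := lFunction_three_of_truth rowC htruth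
    simp only [rowC, List.getD_cons_succ, List.getD_cons_zero] at h'
    omega
  · have h' := lFunction_three_of_truth rowB htruth
    simp only [rowB, List.getD_cons_succ, List.getD_cons_zero] at h'
    omega
  · exact f_eq_charTwist_eightyEight D₈₈ D htruth

/-- **`aₙ(D.f) = χ₋₄(n)·aₙ(φ)` for ALL `n`** on the `176c` row (`⇑φ = ⇑Φ₄₄`, `a₃(W) = −1`) — the input `hf` of desc's
`abs_maninConstant_eq_one_oneSeventySixC_of_cuspCoeff/_of_rootDatum` (take `φ = D₀.f`, `hφ = f_apply_eq_phi44 D₀`).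
[cite: Shimura1971, Prop. 3.64] [cite: CremonaAlgorithms1997, Table 1 (176c)] -/
theorem cuspCoeff_f_eq_chi_mul {W : WeierstrassCurve ℚ} [W.IsElliptic] (D : ModularParametrizationData W 176)
    (φ : CuspForm (Gamma0 44) 2) (hφ : ⇑φ = ⇑Phi44) (h3 : W.LFunction 3 = -1) (n : ℕ) :
    cuspCoeff D.f n = (ZMod.χ₄ n : ℂ) * cuspCoeff φ n := by
  rw [f_eq_charTwist_of_lFunction_three D φ hφ h3,
    cuspCoeff_charTwist 176 _ _ isQuadratic_χ₄_ringHomComp isPrimitive_χ₄_ringHomComp, χ₄_ringHomComp_apply_natCast]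

/-- **Root-datum form of the `176c` row**: for `X₀(44)`- and `X₀(176)`-data `D₀`, `D` with `a₃(W) = −1`,
`aₙ(D.f) = χ₋₄(n)·aₙ(D₀.f)` for all `n`. [cite: CremonaAlgorithms1997, Table 1 (176c), Table 3 (N = 44)] -/
theorem cuspCoeff_f_eq_chi_mul_of_rootDatum {W₀ : WeierstrassCurve ℚ} [W₀.IsElliptic] (D₀ : ModularParametrizationData W₀ 44)
    {W : WeierstrassCurve ℚ} [W.IsElliptic] (D : ModularParametrizationData W 176) (h3 : W.LFunction 3 = -1) (n : ℕ) :
    cuspCoeff D.f n = (ZMod.χ₄ n : ℂ) * cuspCoeff D₀.f n :=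
  cuspCoeff_f_eq_chi_mul D D₀.f (f_apply_eq_phi44 D₀) h3 n

/-- **`176b` row, all coefficients**: `a₃(W) = 1 ⇒ aₙ(D.f) = χ₋₄(n)·aₙ(φ₁₁)` for all `n`. [cite: CremonaAlgorithms1997, Table 1 (176b)] -/
theorem cuspCoeff_f_eq_chi_mul_phi11 {W : WeierstrassCurve ℚ} [W.IsElliptic] (D : ModularParametrizationData W 176)
    (h3 : W.LFunction 3 = 1) (n : ℕ) :
    cuspCoeff D.f n = (ZMod.χ₄ n : ℂ) * cuspCoeff cuspFormEtaProductEleven n := by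
  rw [f_eq_charTwist_eleven_of_lFunction_three D h3,
    cuspCoeff_charTwist 176 _ _ isQuadratic_χ₄_ringHomComp isPrimitive_χ₄_ringHomComp, χ₄_ringHomComp_apply_natCast]

/-- **`176a` row, all coefficients**: `a₃(W) = 3 ⇒ aₙ(D.f) = χ₋₄(n)·aₙ(D₈₈.f)` for all `n`, for every `X₀(88)`-datum `D₈₈`.
[cite: CremonaAlgorithms1997, Table 1 (176a, 88a)] -/
theorem cuspCoeff_f_eq_chi_mul_of_rootDatum88 {W₈₈ : WeierstrassCurve ℚ} [W₈₈.IsElliptic]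
    (D₈₈ : ModularParametrizationData W₈₈ 88) {W : WeierstrassCurve ℚ} [W.IsElliptic] (D : ModularParametrizationData W 176)
    (h3 : W.LFunction 3 = 3) (n : ℕ) :
    cuspCoeff D.f n = (ZMod.χ₄ n : ℂ) * cuspCoeff D₈₈.f n := by
  rw [f_eq_charTwist_eightyEight_of_lFunction_three D₈₈ D h3,
    cuspCoeff_charTwist 176 _ _ isQuadratic_χ₄_ringHomComp isPrimitive_χ₄_ringHomComp, χ₄_ringHomComp_apply_natCast]

end Summit.BirchSwinnertonDyer.BirchSwinnertonDyer.Theorems.ManinLocalTwoThree.PinningOneSeventySix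

end
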